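import Summits.ResolutionOfSingularities.ResolutionOfSingularities.Theorems.FrobeniusClosingSteerPowLimit
import Literature.AlgebraicGeometry.Resolution.RegularLocalOrder
import Literature.AlgebraicGeometry.Resolution.RegularLocalRingsQuotient
import Mathlib.Algebra.CharP.Two
import HarnessLib

/-!
# Crux `Steer` (stmt-ResolutionOfSingularities-16345), chain W4.1 — EVEN TANGENTIAL NORMAL FORM:
# at an even tangential stage `f = h² + x·A + B` one may take `A ∈ 𝔪^(d-1)`

OURS (campaign `res-hironaka`, rung L ★L-G4, slot W4.1; seat res-L0-w41-stub-4 g7 on res-L0-w41-plan-1 RULINGS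
125d / 126b 2026-08-27, «idea-3's normalisation», res-L0-w41-idea-3 CONSULT NOTE 12:40:31Z (ii)); replaces the role of
no printed item; NOT a statement of the manuscript under review [claim: Hironaka2017, status: under-review];
AI-produced, weaker than expert review. Theses-free and definition-free; consumers: the hEv route (RULINGS 123c/124a),
res-type-062's even branch, res-L0-w41-tri-1's (ρ1) audit.

SETTING. `S` a regular local ring of characteristic `2` (any dimension), `x ∈ 𝔪 ∖ 𝔪²` (a member of a regular system
of parameters), `d = 2e`, and a presentation `f = h² + x·A + B` with `B ∈ 𝔪^d` (at an even tangential stage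
`B = σ·τ·H₀²`, `σ, τ ∈ 𝔪`, `H₀ ∈ 𝔪^(e-1)`) together with an OPTIMAL CLEANER `g`: `f − g² ∈ 𝔪^d`.

* `mem_pow_sup_span_singleton_of_pow_mem` — **the order of `S ⧸ (x)` is a valuation**: `uⁿ ∈ 𝔪^(n·e) + (x)` forces
  `u ∈ 𝔪^e + (x)` (`S ⧸ (x)` is regular local, tree `IsRegularLocalRing.quotient_span_singleton`, and the tree's
  order additivity `PowLimit.mem_pow_of_pow_mem_pow_mul` there).
* `mem_pow_of_mul_mem_pow_succ` — `x·a ∈ 𝔪^(k+1)`, `x ∉ 𝔪²` ⇒ `a ∈ 𝔪^k` (tree `mul_not_mem_pow_of_not_mem_pow`).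
* **`exists_normalForm`** — THE NORMALISATION, in ONE step (no iteration, no `gr`-UFD): there are `δ` and
  `A' = A − x·δ²` with `f = (h + x·δ)² + x·A' + B`, **`A' ∈ 𝔪^(2e-1)`** and `g − (h + x·δ) ∈ 𝔪^e`.
  Mechanism: in characteristic `2`, `(g − h)² = (f − g²) + x·A + B ≡ (f − g²) + B  (mod x)`, which lies in `𝔪^(2e)`;
  so `g − h ∈ 𝔪^e + (x)`, say `g − h = m + x·δ`; then `x·(A − x·δ²) = (f − g²) + m² − B ∈ 𝔪^(2e)` and `x ∉ 𝔪²`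
  give `A − x·δ² ∈ 𝔪^(2e-1)`. The `B`-part is untouched.
* `exists_normalForm_of_mem` — the same with the order bookkeeping `h + x·δ ∈ 𝔪^e` (from `f ∈ 𝔪^(2e)`) and
  `δ ∈ 𝔪^(e-1)` (if moreover `h ∈ 𝔪^e`).
* `sub_sq_mem_pow_of_normalForm` — the new `h + x·δ` is again an optimal cleaner (`f − (h + x·δ)² ∈ 𝔪^(2e)`).
* `exists_normalForm_tangential` — the even-tangential-stage spelling `B = σ·τ·H₀²`.
* `sub_sq_mem_sq_span_of_dvd` — the consequence used by the (ρ1) audit: if `ℓ ∣ H₀` then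
  `f − h² = x·A + c·H₀² ∈ (x, A, ℓ)²` (any commutative ring).

[cite: ZariskiSamuel1960, Ch. VIII §1 Thm. 1] [cite: Matsumura1987, Thm. 14.2] [folklore]
bears_on: LADDER-RESOLUTION L ★L-G4 W4.1 (crux `Steer`, hEv / even branch).
-/

noncomputable section

-- `Summit.<S>.<S>.…` duplicates the summit name by design (single-problem summit).
set_option linter.dupNamespace false

open IsLocalRing

namespace Summit.ResolutionOfSingularities.ResolutionOfSingularities.Theorems.SwitchingDichotomy.EvenTangentialNormalForm

open Literature.AlgebraicGeometry.Resolution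

universe u

variable {S : Type u} [CommRing S]

/-- **The order of `S ⧸ (x)` is a valuation** (`x ∈ 𝔪 ∖ 𝔪²` in a regular local ring `S`): if
`u ^ n ∈ 𝔪^(n·e) + (x)` with `n ≥ 1`, then `u ∈ 𝔪^e + (x)`. (`S ⧸ (x)` is a regular local ring, Matsumura 14.2,
and the order function of a regular local ring is additive.)
[cite: Matsumura1987, Thm. 14.2] [cite: ZariskiSamuel1960, Ch. VIII §1 Thm. 1] -/
theorem mem_pow_sup_span_singleton_of_pow_mem [IsRegularLocalRing S] {x : S} (hx : x ∈ maximalIdeal S)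
    (hx2 : x ∉ maximalIdeal S ^ 2) {n : ℕ} (hn : 0 < n) {u : S} {e : ℕ}
    (hu : u ^ n ∈ maximalIdeal S ^ (n * e) ⊔ Ideal.span {x}) :
    u ∈ maximalIdeal S ^ e ⊔ Ideal.span {x} := by
  haveI := (IsRegularLocalRing.quotient_span_singleton hx hx2).1
  set π := Ideal.Quotient.mk (Ideal.span ({x} : Set S)) with hπ
  have hπs : Function.Surjective π := Ideal.Quotient.mk_surjective
  have hmap : (maximalIdeal S).map π = maximalIdeal (S ⧸ Ideal.span ({x} : Set S)) :=
    IsLocalRing.map_maximalIdeal_of_surjective π hπs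
  -- push `hu` to the quotient
  have hu' : π u ^ n ∈ maximalIdeal (S ⧸ Ideal.span ({x} : Set S)) ^ (n * e) := by
    rw [← hmap, ← Ideal.map_pow, ← map_pow]
    have : (maximalIdeal S ^ (n * e) ⊔ Ideal.span {x}).map π = (maximalIdeal S ^ (n * e)).map π := by
      rw [Ideal.map_sup, Ideal.map_quotient_self, sup_bot_eq]
    rw [← this]
    exact Ideal.mem_map_of_mem π hu
  have hu'' : π u ∈ maximalIdeal (S ⧸ Ideal.span ({x} : Set S)) ^ e :=
    PowLimit.mem_pow_of_pow_mem_pow_mul hn hu'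
  -- pull back
  rw [← hmap, ← Ideal.map_pow, Ideal.mem_map_iff_of_surjective π hπs] at hu''
  obtain ⟨m, hm, hmu⟩ := hu''
  rw [hπ, Ideal.Quotient.eq] at hmu
  rw [show u = m - (m - u) by ring]
  exact Ideal.sub_mem _ (Ideal.mem_sup_left hm) (Ideal.mem_sup_right hmu)

/-- In a regular local ring, `x·a ∈ 𝔪^(k+1)` and `x ∉ 𝔪²` force `a ∈ 𝔪^k` (`ord(x·a) = 1 + ord a`).
[cite: ZariskiSamuel1960, Ch. VIII §1 Thm. 1] -/
theorem mem_pow_of_mul_mem_pow_succ [IsRegularLocalRing S] {x : S} (hx2 : x ∉ maximalIdeal S ^ 2) {a : S}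
    {k : ℕ} (h : x * a ∈ maximalIdeal S ^ (k + 1)) : a ∈ maximalIdeal S ^ k := by
  rcases k with _ | k
  · simp
  by_contra ha
  exact mul_not_mem_pow_of_not_mem_pow (p := 1) (q := k) hx2 ha (by simpa [add_comm, add_assoc] using h)

/-- **Even tangential normal form — the normalisation `A ∈ 𝔪^(d-1)`** (res-L0-w41-idea-3 (ii), RULING 125d).
Let `S` be a regular local ring of characteristic `2`, `x ∈ 𝔪 ∖ 𝔪²`, and `f = h² + x·A + B` with `B ∈ 𝔪^(2e)`;
let `g` be an optimal cleaner, `f − g² ∈ 𝔪^(2e)`. Then for some `δ` and `A' = A − x·δ²`: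
`f = (h + x·δ)² + x·A' + B`, `A' ∈ 𝔪^(2e-1)`, and the new `h + x·δ` agrees with `g` modulo `𝔪^e`.
One step, no iteration: `(g − h)² ≡ (f − g²) + B (mod x)` lies in `𝔪^(2e)`, so `g − h ∈ 𝔪^e + (x)`. [folklore] -/
theorem exists_normalForm [IsRegularLocalRing S] [CharP S 2] {x : S} (hx : x ∈ maximalIdeal S)
    (hx2 : x ∉ maximalIdeal S ^ 2) {e : ℕ} {f g h A B : S} (hf : f = h ^ 2 + x * A + B)
    (hB : B ∈ maximalIdeal S ^ (2 * e)) (hg : f - g ^ 2 ∈ maximalIdeal S ^ (2 * e)) :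
    ∃ δ A' : S, A' = A - x * δ ^ 2 ∧ f = (h + x * δ) ^ 2 + x * A' + B ∧
      A' ∈ maximalIdeal S ^ (2 * e - 1) ∧ g - (h + x * δ) ∈ maximalIdeal S ^ e := by
  -- `(g - h)² = g² - h² = -(f - g²) + x·A + B` in characteristic 2
  have hsq : (g - h) ^ 2 = -(f - g ^ 2) + B + A * x := by
    rw [sub_pow_char, hf]; ring
  have hu : (g - h) ^ 2 ∈ maximalIdeal S ^ (2 * e) ⊔ Ideal.span {x} := by
    rw [hsq]
    exact Ideal.add_mem _ (Ideal.mem_sup_left (Ideal.add_mem _ (neg_mem hg) hB))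
      (Ideal.mem_sup_right (Ideal.mul_mem_left _ _ (Ideal.mem_span_singleton_self x)))
  obtain ⟨m, hm, y, hy, hmy⟩ := Submodule.mem_sup.mp (mem_pow_sup_span_singleton_of_pow_mem hx hx2 two_pos hu)
  obtain ⟨δ, rfl⟩ := Ideal.mem_span_singleton'.mp hy
  refine ⟨δ, A - x * δ ^ 2, rfl, ?_, ?_, ?_⟩
  · rw [CharTwo.add_sq, hf]; ring
  · -- `x · (A - x δ²) = (f - g²) + m² - B`
    have hgh : g - (h + x * δ) = m := by
      have : g - h = m + δ * x := hmy.symm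
      linear_combination this
    have key : x * (A - x * δ ^ 2) = (f - g ^ 2) + m ^ 2 - B := by
      rw [← hgh, sub_pow_char, CharTwo.add_sq, hf]
      ring
    rcases Nat.eq_zero_or_pos e with he | he
    · subst he; simp
    have hmem : x * (A - x * δ ^ 2) ∈ maximalIdeal S ^ (2 * e - 1 + 1) := by
      rw [key, show 2 * e - 1 + 1 = 2 * e by omega]
      refine Ideal.sub_mem _ (Ideal.add_mem _ hg ?_) hB
      rw [show 2 * e = e + e by ring, pow_two, pow_add]
      exact Ideal.mul_mem_mul hm hm
    exact mem_pow_of_mul_mem_pow_succ hx2 hmem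
  · have : g - (h + x * δ) = m := by
      have : g - h = m + δ * x := hmy.symm
      linear_combination this
    rw [this]; exact hm

/-- The normal form with ORDER BOOKKEEPING: if moreover `f ∈ 𝔪^(2e)` then the new `h' = h + x·δ` lies in `𝔪^e`
(indeed `g ∈ 𝔪^e` as `g² ∈ 𝔪^(2e)`), and if also `h ∈ 𝔪^e` then `δ ∈ 𝔪^(e-1)`. [folklore] -/
theorem exists_normalForm_of_mem [IsRegularLocalRing S] [CharP S 2] {x : S} (hx : x ∈ maximalIdeal S)
    (hx2 : x ∉ maximalIdeal S ^ 2) {e : ℕ} {f g h A B : S} (hf : f = h ^ 2 + x * A + B)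
    (hB : B ∈ maximalIdeal S ^ (2 * e)) (hg : f - g ^ 2 ∈ maximalIdeal S ^ (2 * e))
    (hfm : f ∈ maximalIdeal S ^ (2 * e)) :
    ∃ δ A' : S, A' = A - x * δ ^ 2 ∧ f = (h + x * δ) ^ 2 + x * A' + B ∧
      A' ∈ maximalIdeal S ^ (2 * e - 1) ∧ g - (h + x * δ) ∈ maximalIdeal S ^ e ∧
      h + x * δ ∈ maximalIdeal S ^ e ∧ (h ∈ maximalIdeal S ^ e → δ ∈ maximalIdeal S ^ (e - 1)) := by
  obtain ⟨δ, A', hA', hf', hA'm, hgh⟩ := exists_normalForm hx hx2 hf hB hg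
  have hge : g ∈ maximalIdeal S ^ e := by
    have hg2 : g ^ 2 ∈ maximalIdeal S ^ (2 * e) := by
      have : g ^ 2 = f - (f - g ^ 2) := by ring
      rw [this]; exact Ideal.sub_mem _ hfm hg
    exact PowLimit.mem_pow_of_pow_mem_pow_mul two_pos hg2
  have hh' : h + x * δ ∈ maximalIdeal S ^ e := by
    have : h + x * δ = g - (g - (h + x * δ)) := by ring
    rw [this]; exact Ideal.sub_mem _ hge hgh
  refine ⟨δ, A', hA', hf', hA'm, hgh, hh', fun hh => ?_⟩
  rcases Nat.eq_zero_or_pos e with he | he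
  · subst he; simp
  have : x * δ ∈ maximalIdeal S ^ (e - 1 + 1) := by
    rw [show e - 1 + 1 = e by omega, show x * δ = (h + x * δ) - h by ring]
    exact Ideal.sub_mem _ hh' hh
  exact mem_pow_of_mul_mem_pow_succ hx2 this

/-- After the normalisation the new `h' = h + x·δ` is itself an optimal cleaner: from `f = h'² + x·A' + B` with
`A' ∈ 𝔪^(2e-1)`, `B ∈ 𝔪^(2e)`, `x ∈ 𝔪` and `1 ≤ e` get `f − h'² ∈ 𝔪^(2e)`. [folklore] -/
theorem sub_sq_mem_pow_of_normalForm [IsLocalRing S] {x : S} (hx : x ∈ maximalIdeal S) {e : ℕ} (he : 1 ≤ e)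
    {f h' A' B : S} (hf : f = h' ^ 2 + x * A' + B) (hA' : A' ∈ maximalIdeal S ^ (2 * e - 1))
    (hB : B ∈ maximalIdeal S ^ (2 * e)) : f - h' ^ 2 ∈ maximalIdeal S ^ (2 * e) := by
  rw [show f - h' ^ 2 = x * A' + B by rw [hf]; ring]
  refine Ideal.add_mem _ ?_ hB
  rw [show 2 * e = 1 + (2 * e - 1) by omega, pow_add, pow_one]
  exact Ideal.mul_mem_mul hx hA'

/-- **Even tangential stage spelling.** At an even tangential stage `f = h² + x·A + σ·τ·H₀²` with `σ, τ ∈ 𝔪`,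
`H₀ ∈ 𝔪^(e-1)`, `1 ≤ e` and an optimal cleaner `g` (`f − g² ∈ 𝔪^(2e)`), one may take `A ∈ 𝔪^(2e-1)`:
`f = (h + x·δ)² + x·A' + σ·τ·H₀²` with `A' = A − x·δ² ∈ 𝔪^(2e-1)` and `g ≡ h + x·δ (mod 𝔪^e)`. [folklore] -/
theorem exists_normalForm_tangential [IsRegularLocalRing S] [CharP S 2] {x σ τ : S} (hx : x ∈ maximalIdeal S)
    (hx2 : x ∉ maximalIdeal S ^ 2) (hσ : σ ∈ maximalIdeal S) (hτ : τ ∈ maximalIdeal S) {e : ℕ} (he : 1 ≤ e)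
    {f g h A H₀ : S} (hH₀ : H₀ ∈ maximalIdeal S ^ (e - 1)) (hf : f = h ^ 2 + x * A + σ * τ * H₀ ^ 2)
    (hg : f - g ^ 2 ∈ maximalIdeal S ^ (2 * e)) :
    ∃ δ A' : S, A' = A - x * δ ^ 2 ∧ f = (h + x * δ) ^ 2 + x * A' + σ * τ * H₀ ^ 2 ∧
      A' ∈ maximalIdeal S ^ (2 * e - 1) ∧ g - (h + x * δ) ∈ maximalIdeal S ^ e := by
  have hB : σ * τ * H₀ ^ 2 ∈ maximalIdeal S ^ (2 * e) := by
    rw [show 2 * e = (1 + 1) + ((e - 1) + (e - 1)) by omega, pow_add, pow_add, pow_add, pow_one, pow_two]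
    exact Ideal.mul_mem_mul (Ideal.mul_mem_mul hσ hτ) (Ideal.mul_mem_mul hH₀ hH₀)
  exact exists_normalForm hx hx2 hf hB hg

/-- **The (ρ1)-consequence** (any commutative ring): if `f = h² + x·A + c·H₀²` and `ℓ ∣ H₀`, then
`f − h² ∈ (x, A, ℓ)²` — `x·A ∈ (x, A)²` and `c·H₀² ∈ (ℓ)²`; hence `f − h² ∈ Q²` for every ideal `Q ⊇ (x, A, ℓ)`
(the (ρ1) bookkeeping of the singular primes coming from a linear factor `ℓ` of `H₀`). [folklore] -/
theorem sub_sq_mem_sq_span_of_dvd {x f h A c H₀ ℓ : S} (hf : f = h ^ 2 + x * A + c * H₀ ^ 2) (hℓ : ℓ ∣ H₀) :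
    f - h ^ 2 ∈ Ideal.span {x, A, ℓ} ^ 2 := by
  obtain ⟨H₁, rfl⟩ := hℓ
  have hxI : x ∈ Ideal.span ({x, A, ℓ} : Set S) := Ideal.subset_span (by simp)
  have hAI : A ∈ Ideal.span ({x, A, ℓ} : Set S) := Ideal.subset_span (by simp)
  have hℓI : ℓ ∈ Ideal.span ({x, A, ℓ} : Set S) := Ideal.subset_span (by simp)
  have : f - h ^ 2 = x * A + (c * H₁ ^ 2) * (ℓ * ℓ) := by rw [hf]; ring
  rw [this, pow_two]
  exact Ideal.add_mem _ (Ideal.mul_mem_mul hxI hAI) (Ideal.mul_mem_left _ _ (Ideal.mul_mem_mul hℓI hℓI))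

end Summit.ResolutionOfSingularities.ResolutionOfSingularities.Theorems.SwitchingDichotomy.EvenTangentialNormalForm

end
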